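import Mathlib.Analysis.InnerProductSpace.Dual
import Mathlib.Analysis.InnerProductSpace.PiL2

/-!
# Kähler metrics osculate the flat metric to order two: the linear algebra (Voisin, Prop. 3.14)

Pointwise algebra behind the existence of holomorphic coordinates in which a Kähler metric is
Euclidean up to second order (C. Voisin, *Hodge Theory and Complex Algebraic Geometry I* (2002),
Prop. 3.14: "`h` is Kähler iff near every point there are holomorphic coordinates in which
`h = ∑ dzᵢ dz̄ᵢ + O(|z|²)`"; Griffiths–Harris (1978), p. 107). Data: a real inner product space
`V` (a tangent space, metric `g = ⟪·,·⟫`), a complex structure `J` which is `g`-orthogonal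
(Hermitian metric), and the first jet of the metric at the point, a continuous linear map
`D : V →L[ℝ] V →L[ℝ] V →L[ℝ] ℝ`, `u ↦ D_u g` (the derivative of the coefficient form of `g` in a
holomorphic chart), symmetric (`D u a b = D u b a`) and Hermitian (`D u (Ja) (Jb) = D u a b`).
The Kähler condition `dω = 0` at the point, for `ω(a, b) = g(Ja, b)`, reads
`D u (Jv) w - D v (Ju) w + D w (Ju) v = 0`.

* the vector `B(u, v) = (toDual ℝ V).symm (½ (D u v + D v u - (D.flip u).flip v))` with
  `⟪B(u,v), w⟫ = ½ (D u v w + D v u w - D w u v)` (Koszul's formula for the Levi-Civita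
  connection on constant vector fields; written out in every statement, no definition);
* `inner_koszul` (the defining identity), `koszul_symm` (`B(u,v) = B(v,u)`),
  `koszul_metric` (`D u v w = ⟪B(u,v), w⟫ + ⟪v, B(u,w)⟫`), and the main point
  `koszul_J` : under the Kähler condition, `B(u, Jv) = J B(u, v)` — `B` is `ℂ`-bilinear, so that
  `z ↦ z + ½ B(z, z)` is a *holomorphic* change of coordinates killing the first jet of the metric
  (`koszul_metric` is exactly `D(φ_* g)(0) = 0` for this `φ`). Classical equivalent formulation:
  a Hermitian metric is Kähler iff its Levi-Civita connection commutes with `J` (Voisin (2002),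
  Thm. 3.13; Huybrechts (2005), Prop. 4.A.7/4.A.8).

## References

* C. Voisin, *Hodge Theory and Complex Algebraic Geometry I* (2002), §3.1.3, Thm. 3.13,
  Prop. 3.14; §3.2.1. [Voisin2002]
* P. Griffiths, J. Harris, *Principles of Algebraic Geometry* (1978), p. 107. [GriffithsHarris1978]
-/

noncomputable section

open scoped RealInnerProductSpace

namespace Literature.Geometry.Kaehler

variable {V : Type*} [NormedAddCommGroup V] [InnerProductSpace ℝ V] [CompleteSpace V]

/-- **Koszul's formula**, defining identity: `⟪B(u,v), w⟫ = ½ (D_u g(v,w) + D_v g(u,w) - D_w g(u,v))`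
(the Levi-Civita connection on constant vector fields; Voisin (2002), §3.2.1). [cite: Voisin2002, §3.2.1] -/
theorem inner_koszul (D : V →L[ℝ] V →L[ℝ] V →L[ℝ] ℝ) (u v w : V) :
    ⟪(InnerProductSpace.toDual ℝ V).symm ((2⁻¹ : ℝ) • (D u v + D v u - (D.flip u).flip v)), w⟫ =
      2⁻¹ * (D u v w + D v u w - D w u v) := by
  rw [InnerProductSpace.toDual_symm_apply]
  simp only [_root_.smul_apply, _root_.add_apply, _root_.sub_apply, ContinuousLinearMap.flip_apply,
    smul_eq_mul]

/-- **Torsion-freeness**: `B(u,v) = B(v,u)` when each `D_u g` is symmetric. [cite: Voisin2002, §3.2.1] -/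
theorem koszul_symm (D : V →L[ℝ] V →L[ℝ] V →L[ℝ] ℝ) (hDsymm : ∀ u a b, D u a b = D u b a)
    (u v : V) :
    (InnerProductSpace.toDual ℝ V).symm ((2⁻¹ : ℝ) • (D u v + D v u - (D.flip u).flip v)) =
      (InnerProductSpace.toDual ℝ V).symm ((2⁻¹ : ℝ) • (D v u + D u v - (D.flip v).flip u)) := by
  refine ext_inner_right ℝ fun w ↦ ?_
  rw [inner_koszul, inner_koszul, hDsymm w u v]
  ring

/-- **Metric compatibility**: `D_u g(v,w) = ⟪B(u,v), w⟫ + ⟪v, B(u,w)⟫` — for the quadratic change of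
coordinates `φ(z) = z + ½B(z,z)` this says that the first jet of the pushed-forward metric vanishes,
`D(φ_* g)(0) = 0` (Voisin (2002), Prop. 3.14). [cite: Voisin2002, Prop. 3.14] -/
theorem koszul_metric (D : V →L[ℝ] V →L[ℝ] V →L[ℝ] ℝ) (hDsymm : ∀ u a b, D u a b = D u b a)
    (u v w : V) :
    D u v w = ⟪(InnerProductSpace.toDual ℝ V).symm ((2⁻¹ : ℝ) • (D u v + D v u - (D.flip u).flip v)), w⟫ +
      ⟪v, (InnerProductSpace.toDual ℝ V).symm ((2⁻¹ : ℝ) • (D u w + D w u - (D.flip u).flip w))⟫ := by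
  rw [real_inner_comm _ v, inner_koszul, inner_koszul, hDsymm u w v, hDsymm w u v, hDsymm v u w]
  ring

/-- **Kähler ⇒ the Koszul map is `ℂ`-bilinear** (the heart of Voisin's Prop. 3.14 / Thm. 3.13:
a Hermitian metric is Kähler iff its Levi-Civita connection is `ℂ`-linear). Hypotheses: `J` is a
`g`-skew complex structure (`⟪Ja, b⟫ = -⟪a, Jb⟫`, `J(Jv) = -v`), the metric jet `D` is symmetric
and Hermitian (`D u (Ja) (Jb) = D u a b`, the derivative of `g(Ja, Jb) = g(a, b)`), and the Kähler
condition `dω = 0` at the point in the form `D u (Jv) w - D v (Ju) w + D w (Ju) v = 0`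
(`ω(a,b) = g(Ja,b)`, constant vector fields). Conclusion: `B(u, Jv) = J B(u, v)`. Proof: pair with
`w`; by skewness the claim is `⟪B(u,Jv), w⟫ + ⟪B(u,v), Jw⟫ = 0`; expand by Koszul; the `D_u` terms
cancel by the Hermitian symmetry of `D_u`, and the remaining four terms cancel after substituting
the Kähler relation twice (with `(Jv, -Ju, w)` and `(Jw, -Ju, v)`). [cite: Voisin2002, Thm. 3.13, Prop. 3.14] -/
theorem koszul_J (D : V →L[ℝ] V →L[ℝ] V →L[ℝ] ℝ) (J : V →L[ℝ] V)
    (hJJ : ∀ v, J (J v) = -v) (hJskew : ∀ a b, ⟪J a, b⟫ = -⟪a, J b⟫)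
    (hDsymm : ∀ u a b, D u a b = D u b a) (hDJ : ∀ u a b, D u (J a) (J b) = D u a b)
    (hK : ∀ u v w, D u (J v) w - D v (J u) w + D w (J u) v = 0) (u v : V) :
    (InnerProductSpace.toDual ℝ V).symm ((2⁻¹ : ℝ) • (D u (J v) + D (J v) u - (D.flip u).flip (J v))) =
      J ((InnerProductSpace.toDual ℝ V).symm ((2⁻¹ : ℝ) • (D u v + D v u - (D.flip u).flip v))) := by
  refine ext_inner_right ℝ fun w ↦ ?_
  rw [hJskew, inner_koszul, inner_koszul]
  -- Hermitian symmetry of `D_a` in the mixed form `D a b (J c) = -D a (J b) c`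
  have hmix : ∀ a b c, D a b (J c) = -D a (J b) c := fun a b c ↦ by
    have := hDJ a (J b) c
    rw [hJJ, map_neg, _root_.neg_apply] at this
    linarith
  -- the Kähler relation with `(Jv, -Ju, w)` and `(Jw, -Ju, v)`
  have k1 := hK (J v) (J u) w
  have k2 := hK (J w) (J u) v
  simp only [hJJ, map_neg, _root_.neg_apply] at k1 k2
  -- linear direction dependence
  have e1 : D u (J v) w + D u v (J w) = 0 := by rw [hmix u v w]; ring
  have e2 : D w v (J u) = -D w (J v) u := hmix w v u
  have e3 : D w u (J v) = -D w (J u) v := hmix w u v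
  have e4 : D v u (J w) = -D v (J u) w := hmix v u w
  have e5 : D v w (J u) = -D v (J w) u := hmix v w u
  have s1 := hDsymm (J u) v w
  have s3 := hDsymm w (J u) v
  have s4 := hDsymm v (J u) w
  linarith

end Literature.Geometry.Kaehler
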